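import Summits.QuantumFields.YangMills.Theorems.BalabanUVNodesN12LeafIntAtRecord13
import Literature.MathematicalPhysics.QuantumFieldTheory.Balaban1983to89.B15Claim189PinsOfHistory

/-!
# BalabanUVNodes ∕ N12 AT THE STAGE-13 TERM-PINNED LAYERS `λᵀ₁₃ := (λ.pinRPrime₁₃ θ).pinD189TH θ.ν θ.A₁ θ.τ9.M (gOfRecord₁₃ θ) σ s N N₀ p₁` and `λᶻ₁₃ := (λ.pinRPrime₁₃ θ).pinD189ZH … enl p₁`
# — the [IV] leaf of RECORD 13's bundle `WOfRecord₁₃ θ λ P` WITH the (1.100) pin equation DISCHARGED (`rfl`) and the (1.89) DISPLAY REPLACED BY ITS PRINTED INPUTS ((1.80) + four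
# ℍ-leaves + located geometry + print's two p. 200 conditions + the run's window ∕ flow inputs), per-run memory `N P`, per-run `N₀ P` (or `N₀` of Record 13)
# (Stage-13 twin of `BalabanUVNodesN12AtRecord12TermPin` ∕ `…TermPinZ`; Track A, DAG node N12 = [B15, Balaban1989LargeFieldI] CMP 122 (1989) 175; cluster K1‴ `StabilityBAtRecordR13e` =
# stmt-QuantumFields-19910 (rev 16; `stub_nodes13` row `h12`); seat `pub-ymgap-dag-n12-e` g5 (R134 s3 «the (1.80)∕(1.89) + R′ (1.99)–(1.100) p.201 chain»), 2026-08-27; count-neutral, NOT a discharge)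

HONEST FRAMING.  Count-neutral kernel BOOKKEEPING BY NAME over dag-n12-d g6's integrable-currency knit (`…N12LeafIntAtRecord13.b15Leaf_WOfRecord₁₃_of_massSel ∕ _of_provisosInt_massSel`) and
this seat's Literature module 14 (`B15Claim189PinsOfHistory`: `ResidW.pinRPrime₁₃`, `pinD189TH ∕ ZH`, `sitOfHist`, `D189OfHist`, `N0OfRecord₁₃`, `claim189_sitOfHist_*`); nothing of Bałaban's
asserted; N12 NOT discharged (5∕27 unchanged); one finite four-torus programme at fixed `ε`; nothing continuum ∕ ℝ⁴ ∕ OS ∕ mass gap ∕ Clay.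
WHY THIS FILE.  At Record 13 the N12 socket of the K1‴ knit is `B15Leaf (θ.res.W P)` (n24-c `N24KnitStage13All`), i.e. `B15Leaf (WOfRecord₁₃ θ λ P)` at the W pin (n10-d `Record13Carriers`).
dag-n12-d's leaf theorem takes, per run: the (1.100) pin equation `hpin`, the denominator masses, the fibre witness, Prop 1, and (1.80) ∕ (1.89) at GENERIC letters `λ.D189 P`.  Here the
layer is this seat's fully pinned Stage-13 layer: `hpin` is `rfl` (module 14 §1), the letters are `D189OfHist θ.ν P (sitOfHist …) (gOfRecord₁₃ θ P)` (objects of record: def-R's background,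
the term's (2.1)-chain, `δ′_k(g)`, `|U_{k,Z}(V_Λ)(∂q) − 1|`, levels `k = kSel P + 1`, `h = k − N P`, `k₀ = k − N₀ P`), and the (1.89) display is DISCHARGED from its printed inputs by
module 14 §6–§7 (`claim189_sitOfHist_of_inInterval ∕ _of_flow ∕ _N0Z_of_flow`, `claim189_sitOfHist₁₃_N0_of_inInterval`).
* §1 `WOfRecord₁₃_pinAllTH ∕ _pinAllZH` (`rfl`: the bundle at the layer IS `WOfRepr` of the ₁₃ tower with the 𝐑-step's own (1.100) reading and the pinned letters), `pinAllTH₁₃_levels`.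
* §2 ★ `b15Leaf_WOfRecord₁₃_pinAllTH_of_massSel` (window form: `Provisos₁₃`, `kSel P < K`, `hmassSel`, `hfib`, Prop 1, (1.80), levels `2 ≤ N₀ P ≤ N P`, `N₀ P ≤ kSel P + 1`, residual
  numerics, print's two p. 200 conditions, `0 ≤ A₀`, `SmallnessFor θ.γ …`, the run's window up to `kSel P + 1` along `gOfRecord₁₃ θ P`, the BOX bound `BetaUpperH β′ θ.γ (betaOfRecord₁₃ θ)`,
  the located geometry, the four ℍ-leaves ⇒ `B15Leaf (WOfRecord₁₃ θ λᵀ₁₃ P)`), ★ `…_of_flow` (window-free: flow inputs displayed — for witness lines whose `γ` is not (2.7)-small),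
  `…_deg_of_flow` (any run: the knit datum's integrable provisos displayed on runs with `K ≤ kSel P`).
* §3 ★ `b15Leaf_WOfRecord₁₃_pinAllZH_N0_of_massSel_of_flow` (`Z″` pinned, `N₀ := N0OfRecord₁₃ θ P (kSel P + 1)`: `hZk` DISCHARGED, `2 ≤ N₀` from `1 < (log g_k⁻²)^r`; window-free) and
  ★ `b15Leaf_WOfRecord₁₃_pinAllTH_N0_of_massSel` (`N₀` of Record 13, window form: `2 ≤ N₀` from `r ≥ 1`, print's first p. 200 condition from one threshold + `β₁₃ ≥ 0` along the history).
* §4 θ-keyed socket faces: `res_W_pinW_pinAllTH` (`rfl` ×2: `(θ.pinW (WOfRecord₁₃ θ λᵀ₁₃)).res.W P = WOfRecord₁₃ θ λᵀ₁₃ P`, and the bundle read at the W-pinned parameter is the same —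
  so §2–§3 ARE n24-c's `h12` row `B15Leaf (θ'.res.W P)` at `θ' := θ.pinW (WOfRecord₁₃ θ λᵀ₁₃)` by `rfl`), `provisos₁₃_pinW_pinAllTH` (`Provisos₁₃` survives the W pin, n10-d).
WHAT N12 THEN COSTS PER RUN at these layers (hypothesis list; typing strength, NOT a second gap): `Provisos₁₃` (K0‴), denominator masses + fibre witness (NODE 00; `hfib` free at an idempotent
selector — dag-n12-d `…LiveLine`), Prop 1 at `λ.LF P` (n12-c), (1.80) at `|U_{k,Z}(V_Λ)(∂q) − 1|` of record and the four ℍ-leaves (N07 ∕ [B11]-at-objects), the located geometry (shell bound, (1.88)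
cover), residual numerics `β ∈ [0,1/4]`, `2 ≤ L₀`, `L₀² ≤ L`, signs, print's second p. 200 condition (`M` large), per-run `N P ≥ N₀ P` with `N₀ P ≤ kSel P + 1`, the run's window ∕ flow inputs.
0 `sorry`, 0 `def`, standard axioms.  Filed `--supports` K1‴ (stmt-QuantumFields-19910) `--as helper`.
Sources: [Balaban1989LargeFieldI] (0.2)–(0.6) p.176, Prop. 1 p.194, (1.80) p.195, (1.89) p.198, pp.199–200, (1.99)–(1.102) pp.200–201; [Balaban1988Convergent] (2.1) p.254, (2.4)–(2.8)
pp.255–256, (2.18) p.257, (3.25) p.270; [Balaban1987RG1] §1 p.264.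
-/

noncomputable section

open MeasureTheory
open scoped Matrix.Norms.L2Operator

namespace Summit.QuantumFields.YangMills.BalabanUVNodes.N12AtRecord13TermPin

open Literature.MathematicalPhysics.QuantumFieldTheory.Balaban1983to89
open Literature.MathematicalPhysics.QuantumFieldTheory.Balaban1983to89.T4Continuum (T4Family)
open Literature.MathematicalPhysics.QuantumFieldTheory.Balaban1983to89.DagBinding (PrintedCarriers15 B15Leaf)
open Literature.MathematicalPhysics.QuantumFieldTheory.Balaban1983to89.Node00
open B15Claim189Assembly (Setting189 new189 chiPP dom half)
open B15Claim189PinsOfHistory (D189OfHist sitOfHist deltaPrimeOfHist N0OfRecord₁₃ claim189_sitOfHist_of_inInterval claim189_sitOfHist_of_flow claim189_sitOfHist_N0Z_of_flow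
  claim189_sitOfHist₁₃_N0_of_inInterval)
open B15Claim189PrintedConditions (omegaOfChain)
open B15Claim189N0OfRecord (N0OfSeq)
open B15DeterminingSets (MSField)
open B15 (Prop1Printed Ineq180)
open B15.BasicStep (Claim189)
open B15.PrelimIntegrations (Ineq191 Ineq195)
open B15Chi124DetSets (E124)
open B14DomainGeom (Pt)
open B8Eq17ClassAkV1 (plaqsOf)
open GaugeGroup (dist1)
open GaugeField (plaqHol)
open FlowStep (prefixOf BetaUpperH)
open B14FlowStep (SmallnessFor)
open B15RPrime1100OfRep (rPrimeDataOfSel)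
open B15LeafKnitRepr (WOfRepr)
open B15RopTotal (RepData)
open Summit.QuantumFields.YangMills.BalabanUVNodes.N12LeafIntAtRecord13 (b15Leaf_WOfRecord₁₃_of_massSel b15Leaf_WOfRecord₁₃_of_provisosInt_massSel)

variable {N : ℕ} [NeZero N] {F : T4Family}

/-! ## §1 The Stage-13 term-pinned layers: the bundle of record at them (`rfl`) -/

section Layer

variable (θ : Stage13Params F N) (lam : ResidW F N) (σ : ∀ P : B12.RunParams, Sit189 F N P.K)
  (s : ∀ P : B12.RunParams, SeqOfRecord F θ.ν θ.τ9.M (gOfRecord₁₃ F N θ P) P.K (lam.kSel P + 1)) (Nm N₀ : B12.RunParams → ℕ)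
  (enl : ∀ P : B12.RunParams, ℕ → ℕ → Set (Site (F.P P.K) 0) → Set (Site (F.P P.K) 0)) (p₁ : ℕ)

/-- **RECORD 13's [IV] BUNDLE AT THE TERM-PINNED LAYER `λᵀ₁₃`** (`rfl`): `WOfRepr` of the Stage-13 pre-𝐑 tower `reprTOfRecord₁₃ θ P (kSel P)` with selector and fibres along `gOfRecord₁₃ θ P`, the
Proposition-1 carrier `λ.LF P`, the (1.89) letters `D189OfHist θ.ν P (sitOfHist …) (gOfRecord₁₃ θ P)` and the 𝐑-step's OWN (1.100) reading — the shape dag-n12-d's integrable-currency knit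
consumes, `hpin` by `rfl`. [cite: Balaban1989LargeFieldI, (0.2) p.176, (1.89) p.198, (1.100) p.201 (bookkeeping)] -/
theorem WOfRecord₁₃_pinAllTH (P : B12.RunParams) :
    WOfRecord₁₃ F N θ ((lam.pinRPrime₁₃ θ).pinD189TH θ.ν θ.A₁ θ.τ9.M (gOfRecord₁₃ F N θ) σ s Nm N₀ p₁) P =
      WOfRepr (reprTOfRecord₁₃ F N θ P (lam.kSel P)) (θ.ppSel P (gOfRecord₁₃ F N θ P) (lam.kSel P + 1)) (fibOfSeq F θ.ν θ.τ9 P (gOfRecord₁₃ F N θ P) (lam.kSel P + 1))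
        (lam.LF P) (D189OfHist θ.ν P (sitOfHist θ.ν θ.A₁ θ.τ9.M (Nm P) P (σ P) (gOfRecord₁₃ F N θ P) (s P) (N₀ P) p₁) (gOfRecord₁₃ F N θ P))
        (rPrimeDataOfSel (reprTOfRecord₁₃ F N θ P (lam.kSel P)) (θ.ppSel P (gOfRecord₁₃ F N θ P) (lam.kSel P + 1))
          (fibOfSeq F θ.ν θ.τ9 P (gOfRecord₁₃ F N θ P) (lam.kSel P + 1))) := rfl

/-- … and at the `Z″`-pinned layer `λᶻ₁₃` (`rfl`). [cite: Balaban1989LargeFieldI, (0.2) p.176, (1.10)–(1.11) p.179, (1.100) p.201 (bookkeeping)] -/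
theorem WOfRecord₁₃_pinAllZH (P : B12.RunParams) :
    WOfRecord₁₃ F N θ ((lam.pinRPrime₁₃ θ).pinD189ZH θ.ν θ.A₁ θ.τ9.M (gOfRecord₁₃ F N θ) σ s Nm N₀ enl p₁) P =
      WOfRepr (reprTOfRecord₁₃ F N θ P (lam.kSel P)) (θ.ppSel P (gOfRecord₁₃ F N θ P) (lam.kSel P + 1)) (fibOfSeq F θ.ν θ.τ9 P (gOfRecord₁₃ F N θ P) (lam.kSel P + 1))
        (lam.LF P)
        (D189OfHist θ.ν P (sitOfHist θ.ν θ.A₁ θ.τ9.M (Nm P) P ((σ P).pinZpp (s P) (N₀ P) (Nm P) (enl P)) (gOfRecord₁₃ F N θ P) (s P) (N₀ P) p₁) (gOfRecord₁₃ F N θ P))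
        (rPrimeDataOfSel (reprTOfRecord₁₃ F N θ P (lam.kSel P)) (θ.ppSel P (gOfRecord₁₃ F N θ P) (lam.kSel P + 1))
          (fibOfSeq F θ.ν θ.τ9 P (gOfRecord₁₃ F N θ P) (lam.kSel P + 1))) := rfl

/-- The levels of the letters at both layers: `k = kSel P + 1`, `h = k − N P`, `k₀ = k − N₀ P` (`rfl`). [cite: Balaban1989LargeFieldI, p.177, p.178, p.181 (bookkeeping)] -/
theorem pinAll₁₃_levels (P : B12.RunParams) :
    (((lam.pinRPrime₁₃ θ).pinD189TH θ.ν θ.A₁ θ.τ9.M (gOfRecord₁₃ F N θ) σ s Nm N₀ p₁).D189 P).k = lam.kSel P + 1 ∧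
    (((lam.pinRPrime₁₃ θ).pinD189TH θ.ν θ.A₁ θ.τ9.M (gOfRecord₁₃ F N θ) σ s Nm N₀ p₁).D189 P).h = lam.kSel P + 1 - Nm P ∧
    (((lam.pinRPrime₁₃ θ).pinD189TH θ.ν θ.A₁ θ.τ9.M (gOfRecord₁₃ F N θ) σ s Nm N₀ p₁).D189 P).k₀ = lam.kSel P + 1 - N₀ P ∧
    (((lam.pinRPrime₁₃ θ).pinD189ZH θ.ν θ.A₁ θ.τ9.M (gOfRecord₁₃ F N θ) σ s Nm N₀ enl p₁).D189 P).k = lam.kSel P + 1 := ⟨rfl, rfl, rfl, rfl⟩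

end Layer

/-! ## §2 The [IV] leaf of Record 13's bundle at `λᵀ₁₃` — (1.100) pin `rfl`, (1.89) from its printed inputs -/

section LeafT

variable (θ : Stage13Params F N) (lam : ResidW F N) (σ : ∀ P : B12.RunParams, Sit189 F N P.K)
  (s : ∀ P : B12.RunParams, SeqOfRecord F θ.ν θ.τ9.M (gOfRecord₁₃ F N θ P) P.K (lam.kSel P + 1)) (Nm N₀ : B12.RunParams → ℕ) (p₁ : ℕ)

/-- **★ THE [IV] LEAF OF RECORD 13's BUNDLE AT THE TERM-PINNED LAYER `λᵀ₁₃`, WINDOW FORM.**  For the letters `D := (λᵀ₁₃).D189 P` (`hD`; instantiate `rfl`): from `Provisos₁₃` (`kSel P < K`),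
the denominator masses `hmassSel`, the fibre witness `hfib`, Prop. 1 at `λ.LF P`, (1.80) (`h180`); and the (1.89) inputs — levels `2 ≤ N₀ P ≤ N P`, `N₀ P ≤ kSel P + 1`; `β ∈ [0, 1/4]`, `2 ≤ L₀`,
`L₀² ≤ L`, `0 ≤ O(1)B₃B₅`, `0 ≤ δ`, `dist ≥ 0`; print's two p. 200 conditions at the record's `M = τ9.M`; `0 ≤ A₀`, `SmallnessFor θ.γ …`, `β₀ ≤ ½`, `γA₀(log γ⁻²)^{p₀} ≤ 1/10`, the run's window
up to `kSel P + 1` ALONG `gOfRecord₁₃ θ P`, the BOX bound on `betaOfRecord₁₃ θ`; `Z″_k ∩ Ω_m ⊆ Ω_{m+1}`, the shell bound, the (1.88) cover; the four ℍ-leaves.  The (1.100) pin equation is `rfl`.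
[cite: Balaban1989LargeFieldI, (0.2)–(0.6) p.176, p.176 ll.14–16, Prop. 1 (1.78) p.194, (1.80) p.195, (1.89) p.198, pp.199–200, (1.99)–(1.102) pp.200–201; Balaban1988Convergent, (2.1) p.254, (2.8) p.256] -/
theorem b15Leaf_WOfRecord₁₃_pinAllTH_of_massSel (hP : θ.Provisos₁₃ F N) {P : B12.RunParams} (hk : lam.kSel P < P.K)
    {D : Setting189 (F.P P.K) (SU N) (MSField (F.P P.K) (SU N) × ((j : ℕ) → VecField (F.P P.K) j (EuclideanSpace ℝ (Fin (N ^ 2 - 1))))) (Pt (F.P P.K).d)}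
    (hD : D = ((lam.pinRPrime₁₃ θ).pinD189TH θ.ν θ.A₁ θ.τ9.M (gOfRecord₁₃ F N θ) σ s Nm N₀ p₁).D189 P)
    (hmassSel : ∀ t, 0 < ∫ V, rterm (reprTOfRecord₁₃ F N θ P (lam.kSel P)) (θ.ppSel P (gOfRecord₁₃ F N θ P) (lam.kSel P + 1) t) V
      ∂(fieldMeasure (F.P P.K) (lam.kSel P + 1) (SU N)))
    (hfib : ∀ t, ∃ t', θ.ppSel P (gOfRecord₁₃ F N θ P) (lam.kSel P + 1) t' = θ.ppSel P (gOfRecord₁₃ F N θ P) (lam.kSel P + 1) t ∧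
      0 < ∫ V, rterm (reprTOfRecord₁₃ F N θ P (lam.kSel P)) t' V ∂(fieldMeasure (F.P P.K) (lam.kSel P + 1) (SU N)))
    (hP1 : Prop1Printed (lam.LF P))
    (h180 : ∀ U, new189 D U → ∀ i, D.h ≤ i → i ≤ D.k → ∀ q ∈ plaqsOf (dom D i), Ineq180 (D.dev0 U q) (D.ε D.k) D.η D.B₃ D.B₅ D.M D.δ (D.dist q) D.O1)
    -- the (1.89) inputs
    (hN2 : 2 ≤ N₀ P) (hNN : N₀ P ≤ Nm P) (hNk : N₀ P ≤ lam.kSel P + 1)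
    (hβ0 : 0 ≤ (σ P).β) (hβ : (σ P).β ≤ 1 / 4) (hL₀ : 2 ≤ (σ P).L₀) (hL₀L : (σ P).L₀ ^ 2 ≤ ((F.P P.K).L : ℝ))
    (hB : 0 ≤ (σ P).O1 * (σ P).B₃ * (σ P).B₅) (hδ : 0 ≤ (σ P).δ) (hdist : ∀ p, 0 ≤ (σ P).dist p)
    (hN₀ : (2 + (121 / 120) ^ 2 * ((σ P).O1 * (σ P).B₃ * (σ P).B₅ * (θ.τ9.M : ℝ) ^ 5)) * (((σ P).L₀ ^ 2) ^ (N₀ P - 1))⁻¹ ≤ 1 / 4)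
    (hMl : (121 / 120) ^ 2 * ((σ P).O1 * (σ P).B₃ * (σ P).B₅ * (θ.τ9.M : ℝ) ^ 5) * Real.exp (-(4 * (σ P).δ * (θ.τ9.M : ℝ))) ≤ 1 / 12)
    (hA₀ : 0 ≤ θ.ν.A₀) {β' β₀ : ℝ} {L : ℕ} (S : SmallnessFor θ.γ β' β₀ L θ.ν.p₀) (hβ₀ : β₀ ≤ 1 / 2) (hε10 : θ.γ * p0Profile θ.ν.A₀ θ.ν.p₀ θ.γ ≤ 1 / 10)
    (hI : Step.InInterval θ.γ (lam.kSel P + 1) (gOfRecord₁₃ F N θ P)) (hup : BetaUpperH β' θ.γ (betaOfRecord₁₃ F N θ))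
    (hZk : ∀ m, lam.kSel P + 1 - N₀ P < m → m < lam.kSel P + 1 → (σ P).Zpp (lam.kSel P + 1) ∩ omegaOfChain (s P) m ⊆ omegaOfChain (s P) (m + 1))
    (hgeom : ∀ m, D.k₀ < m → m < D.k → ∀ p ∈ plaqsOf (D.Ω m \ D.Ω (m + 1)), 4 * ((m : ℝ) - D.k₀) * D.M ≤ D.dist p)
    (hbox : ∀ p ∈ plaqsOf (half D), D.boxOf p ∈ D.halfcubes ∧ p ∈ D.plaqT (D.boxOf p))
    (L91h : ∀ U, new189 D U → ∀ p ∈ plaqsOf (half D),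
      Ineq191 (dist1 (plaqHol (D.Upp U) p)) (D.devV'' U p) D.α ((D.L ^ D.h)⁻¹) (D.ε D.h) (E124 D.ε D.L D.η D.k D.h))
    (L95 : ∀ U, new189 D U → ∀ p ∈ plaqsOf (half D),
      Ineq195 (D.devV'' U p) (dist1 (plaqHol (D.Uhalf U (D.boxOf p)) p)) D.α ((D.L ^ D.h)⁻¹) (D.ε D.h) (E124 D.ε D.L D.η D.k D.h))
    (L91 : ∀ U, new189 D U → ∀ j, D.h ≤ j → j ≤ D.k → ∀ p ∈ plaqsOf (dom D j),
      Ineq191 (dist1 (plaqHol (D.Upp U) p)) (D.dev97 U p) D.α ((D.L ^ j)⁻¹) (D.ε j) (E124 D.ε D.L D.η D.k j))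
    (L97 : ∀ U, new189 D U → ∀ j, D.h ≤ j → j ≤ D.k → ∀ p ∈ plaqsOf (dom D j),
      Ineq191 (D.dev97 U p) (D.dev0 U p) D.α ((D.L ^ j)⁻¹) (D.ε j) (E124 D.ε D.L D.η D.k j)) :
    B15Leaf (WOfRecord₁₃ F N θ ((lam.pinRPrime₁₃ θ).pinD189TH θ.ν θ.A₁ θ.τ9.M (gOfRecord₁₃ F N θ) σ s Nm N₀ p₁) P) := by
  subst hD
  exact b15Leaf_WOfRecord₁₃_of_massSel θ _ hP hk rfl hmassSel hfib hP1 h180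
    (claim189_sitOfHist_of_inInterval (Nm P) P (σ P) (N₀ P) p₁ (betaOfRecord₁₃ F N θ) rfl hN2 hNN hNk hβ0 hβ hL₀ hL₀L hB hδ hdist hN₀ hMl hA₀ S hβ₀ hε10 hI
      (B15Claim189FlowAtRecord.betaAlongHistory_le_of_betaUpperH hup hI) hZk hgeom hbox L91h L95 L91 L97 h180)

/-- **★ THE SAME LEAF, WINDOW-FREE FORM** — the flow inputs `0 ≤ ε_i ≤ 1/10` on `[kSel P + 1 − N P, kSel P + 1]` and [III] (2.8) `ε_k ≤ (1+β₀)(k−j)^{1/2}ε_j` DISPLAYED at the thresholds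
`epsOfRecord θ.ν (gOfRecord₁₃ θ P)` instead of read off a window (for witness lines whose `γ` is not (2.7)-small: module 11's `not_smallnessFor_of_half_le`).
[cite: Balaban1989LargeFieldI, (0.2)–(0.6) p.176, Prop. 1 (1.78) p.194, (1.80) p.195, (1.89) p.198, pp.199–200; Balaban1988Convergent, (2.8) p.256] -/
theorem b15Leaf_WOfRecord₁₃_pinAllTH_of_massSel_of_flow (hP : θ.Provisos₁₃ F N) {P : B12.RunParams} (hk : lam.kSel P < P.K)
    {D : Setting189 (F.P P.K) (SU N) (MSField (F.P P.K) (SU N) × ((j : ℕ) → VecField (F.P P.K) j (EuclideanSpace ℝ (Fin (N ^ 2 - 1))))) (Pt (F.P P.K).d)}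
    (hD : D = ((lam.pinRPrime₁₃ θ).pinD189TH θ.ν θ.A₁ θ.τ9.M (gOfRecord₁₃ F N θ) σ s Nm N₀ p₁).D189 P)
    (hmassSel : ∀ t, 0 < ∫ V, rterm (reprTOfRecord₁₃ F N θ P (lam.kSel P)) (θ.ppSel P (gOfRecord₁₃ F N θ P) (lam.kSel P + 1) t) V
      ∂(fieldMeasure (F.P P.K) (lam.kSel P + 1) (SU N)))
    (hfib : ∀ t, ∃ t', θ.ppSel P (gOfRecord₁₃ F N θ P) (lam.kSel P + 1) t' = θ.ppSel P (gOfRecord₁₃ F N θ P) (lam.kSel P + 1) t ∧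
      0 < ∫ V, rterm (reprTOfRecord₁₃ F N θ P (lam.kSel P)) t' V ∂(fieldMeasure (F.P P.K) (lam.kSel P + 1) (SU N)))
    (hP1 : Prop1Printed (lam.LF P))
    (h180 : ∀ U, new189 D U → ∀ i, D.h ≤ i → i ≤ D.k → ∀ q ∈ plaqsOf (dom D i), Ineq180 (D.dev0 U q) (D.ε D.k) D.η D.B₃ D.B₅ D.M D.δ (D.dist q) D.O1)
    (hN2 : 2 ≤ N₀ P) (hNN : N₀ P ≤ Nm P) (hNk : N₀ P ≤ lam.kSel P + 1)
    (hβ0 : 0 ≤ (σ P).β) (hβ : (σ P).β ≤ 1 / 4) (hL₀ : 2 ≤ (σ P).L₀) (hL₀L : (σ P).L₀ ^ 2 ≤ ((F.P P.K).L : ℝ))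
    (hB : 0 ≤ (σ P).O1 * (σ P).B₃ * (σ P).B₅) (hδ : 0 ≤ (σ P).δ) (hdist : ∀ p, 0 ≤ (σ P).dist p)
    (hN₀ : (2 + (121 / 120) ^ 2 * ((σ P).O1 * (σ P).B₃ * (σ P).B₅ * (θ.τ9.M : ℝ) ^ 5)) * (((σ P).L₀ ^ 2) ^ (N₀ P - 1))⁻¹ ≤ 1 / 4)
    (hMl : (121 / 120) ^ 2 * ((σ P).O1 * (σ P).B₃ * (σ P).B₅ * (θ.τ9.M : ℝ) ^ 5) * Real.exp (-(4 * (σ P).δ * (θ.τ9.M : ℝ))) ≤ 1 / 12)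
    (hε0 : ∀ i, lam.kSel P + 1 - Nm P ≤ i → i ≤ lam.kSel P + 1 → 0 ≤ epsOfRecord θ.ν (gOfRecord₁₃ F N θ P) i)
    (hε1 : ∀ i, lam.kSel P + 1 - Nm P ≤ i → i ≤ lam.kSel P + 1 → epsOfRecord θ.ν (gOfRecord₁₃ F N θ P) i ≤ 1 / 10)
    {β₀ : ℝ} (hβ₀0 : 0 ≤ β₀) (hβ₀ : β₀ ≤ 1 / 2)
    (hflow : ∀ j, lam.kSel P + 1 - Nm P ≤ j → j < lam.kSel P + 1 →
      epsOfRecord θ.ν (gOfRecord₁₃ F N θ P) (lam.kSel P + 1) ≤ (1 + β₀) * Real.sqrt ((lam.kSel P + 1 - j : ℕ) : ℝ) * epsOfRecord θ.ν (gOfRecord₁₃ F N θ P) j)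
    (hZk : ∀ m, lam.kSel P + 1 - N₀ P < m → m < lam.kSel P + 1 → (σ P).Zpp (lam.kSel P + 1) ∩ omegaOfChain (s P) m ⊆ omegaOfChain (s P) (m + 1))
    (hgeom : ∀ m, D.k₀ < m → m < D.k → ∀ p ∈ plaqsOf (D.Ω m \ D.Ω (m + 1)), 4 * ((m : ℝ) - D.k₀) * D.M ≤ D.dist p)
    (hbox : ∀ p ∈ plaqsOf (half D), D.boxOf p ∈ D.halfcubes ∧ p ∈ D.plaqT (D.boxOf p))
    (L91h : ∀ U, new189 D U → ∀ p ∈ plaqsOf (half D),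
      Ineq191 (dist1 (plaqHol (D.Upp U) p)) (D.devV'' U p) D.α ((D.L ^ D.h)⁻¹) (D.ε D.h) (E124 D.ε D.L D.η D.k D.h))
    (L95 : ∀ U, new189 D U → ∀ p ∈ plaqsOf (half D),
      Ineq195 (D.devV'' U p) (dist1 (plaqHol (D.Uhalf U (D.boxOf p)) p)) D.α ((D.L ^ D.h)⁻¹) (D.ε D.h) (E124 D.ε D.L D.η D.k D.h))
    (L91 : ∀ U, new189 D U → ∀ j, D.h ≤ j → j ≤ D.k → ∀ p ∈ plaqsOf (dom D j),
      Ineq191 (dist1 (plaqHol (D.Upp U) p)) (D.dev97 U p) D.α ((D.L ^ j)⁻¹) (D.ε j) (E124 D.ε D.L D.η D.k j))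
    (L97 : ∀ U, new189 D U → ∀ j, D.h ≤ j → j ≤ D.k → ∀ p ∈ plaqsOf (dom D j),
      Ineq191 (D.dev97 U p) (D.dev0 U p) D.α ((D.L ^ j)⁻¹) (D.ε j) (E124 D.ε D.L D.η D.k j)) :
    B15Leaf (WOfRecord₁₃ F N θ ((lam.pinRPrime₁₃ θ).pinD189TH θ.ν θ.A₁ θ.τ9.M (gOfRecord₁₃ F N θ) σ s Nm N₀ p₁) P) := by
  subst hD
  exact b15Leaf_WOfRecord₁₃_of_massSel θ _ hP hk rfl hmassSel hfib hP1 h180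
    (claim189_sitOfHist_of_flow (Nm P) P (σ P) (s P) (N₀ P) p₁ rfl hN2 hNN hNk hβ0 hβ hL₀ hL₀L hB hδ hdist hN₀ hMl hε0 hε1 hβ₀0 hβ₀ hflow hZk hgeom hbox
      L91h L95 L91 L97 h180)

/-- **THE SAME LEAF AT ANY RUN** (degenerate-run form): on runs with `K ≤ kSel P` the integrable provisos of the knit datum are DISPLAYED (`hdeg`; no theorem of the record supplies them there —
dag-n12-d's `b15Leaf_WOfRecord₁₃_of_provisosInt_massSel`), below the torus `Provisos₁₃` does; window-free flow inputs. [cite: Balaban1989LargeFieldI, (0.2)–(0.6) p.176, (1.89) p.198, pp.199–200] -/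
theorem b15Leaf_WOfRecord₁₃_pinAllTH_of_deg_massSel_of_flow (hP : θ.Provisos₁₃ F N) {P : B12.RunParams}
    {D : Setting189 (F.P P.K) (SU N) (MSField (F.P P.K) (SU N) × ((j : ℕ) → VecField (F.P P.K) j (EuclideanSpace ℝ (Fin (N ^ 2 - 1))))) (Pt (F.P P.K).d)}
    (hD : D = ((lam.pinRPrime₁₃ θ).pinD189TH θ.ν θ.A₁ θ.τ9.M (gOfRecord₁₃ F N θ) σ s Nm N₀ p₁).D189 P)
    (hdeg : P.K ≤ lam.kSel P →
      (repDataOfSel (reprTOfRecord₁₃ F N θ P (lam.kSel P)) (θ.ppSel P (gOfRecord₁₃ F N θ P) (lam.kSel P + 1))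
        (fibOfSeq F θ.ν θ.τ9 P (gOfRecord₁₃ F N θ P) (lam.kSel P + 1))).ProvisosInt)
    (hmassSel : ∀ t, 0 < ∫ V, rterm (reprTOfRecord₁₃ F N θ P (lam.kSel P)) (θ.ppSel P (gOfRecord₁₃ F N θ P) (lam.kSel P + 1) t) V
      ∂(fieldMeasure (F.P P.K) (lam.kSel P + 1) (SU N)))
    (hfib : ∀ t, ∃ t', θ.ppSel P (gOfRecord₁₃ F N θ P) (lam.kSel P + 1) t' = θ.ppSel P (gOfRecord₁₃ F N θ P) (lam.kSel P + 1) t ∧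
      0 < ∫ V, rterm (reprTOfRecord₁₃ F N θ P (lam.kSel P)) t' V ∂(fieldMeasure (F.P P.K) (lam.kSel P + 1) (SU N)))
    (hP1 : Prop1Printed (lam.LF P))
    (h180 : ∀ U, new189 D U → ∀ i, D.h ≤ i → i ≤ D.k → ∀ q ∈ plaqsOf (dom D i), Ineq180 (D.dev0 U q) (D.ε D.k) D.η D.B₃ D.B₅ D.M D.δ (D.dist q) D.O1)
    (hN2 : 2 ≤ N₀ P) (hNN : N₀ P ≤ Nm P) (hNk : N₀ P ≤ lam.kSel P + 1)
    (hβ0 : 0 ≤ (σ P).β) (hβ : (σ P).β ≤ 1 / 4) (hL₀ : 2 ≤ (σ P).L₀) (hL₀L : (σ P).L₀ ^ 2 ≤ ((F.P P.K).L : ℝ))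
    (hB : 0 ≤ (σ P).O1 * (σ P).B₃ * (σ P).B₅) (hδ : 0 ≤ (σ P).δ) (hdist : ∀ p, 0 ≤ (σ P).dist p)
    (hN₀ : (2 + (121 / 120) ^ 2 * ((σ P).O1 * (σ P).B₃ * (σ P).B₅ * (θ.τ9.M : ℝ) ^ 5)) * (((σ P).L₀ ^ 2) ^ (N₀ P - 1))⁻¹ ≤ 1 / 4)
    (hMl : (121 / 120) ^ 2 * ((σ P).O1 * (σ P).B₃ * (σ P).B₅ * (θ.τ9.M : ℝ) ^ 5) * Real.exp (-(4 * (σ P).δ * (θ.τ9.M : ℝ))) ≤ 1 / 12)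
    (hε0 : ∀ i, lam.kSel P + 1 - Nm P ≤ i → i ≤ lam.kSel P + 1 → 0 ≤ epsOfRecord θ.ν (gOfRecord₁₃ F N θ P) i)
    (hε1 : ∀ i, lam.kSel P + 1 - Nm P ≤ i → i ≤ lam.kSel P + 1 → epsOfRecord θ.ν (gOfRecord₁₃ F N θ P) i ≤ 1 / 10)
    {β₀ : ℝ} (hβ₀0 : 0 ≤ β₀) (hβ₀ : β₀ ≤ 1 / 2)
    (hflow : ∀ j, lam.kSel P + 1 - Nm P ≤ j → j < lam.kSel P + 1 →
      epsOfRecord θ.ν (gOfRecord₁₃ F N θ P) (lam.kSel P + 1) ≤ (1 + β₀) * Real.sqrt ((lam.kSel P + 1 - j : ℕ) : ℝ) * epsOfRecord θ.ν (gOfRecord₁₃ F N θ P) j)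
    (hZk : ∀ m, lam.kSel P + 1 - N₀ P < m → m < lam.kSel P + 1 → (σ P).Zpp (lam.kSel P + 1) ∩ omegaOfChain (s P) m ⊆ omegaOfChain (s P) (m + 1))
    (hgeom : ∀ m, D.k₀ < m → m < D.k → ∀ p ∈ plaqsOf (D.Ω m \ D.Ω (m + 1)), 4 * ((m : ℝ) - D.k₀) * D.M ≤ D.dist p)
    (hbox : ∀ p ∈ plaqsOf (half D), D.boxOf p ∈ D.halfcubes ∧ p ∈ D.plaqT (D.boxOf p))
    (L91h : ∀ U, new189 D U → ∀ p ∈ plaqsOf (half D),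
      Ineq191 (dist1 (plaqHol (D.Upp U) p)) (D.devV'' U p) D.α ((D.L ^ D.h)⁻¹) (D.ε D.h) (E124 D.ε D.L D.η D.k D.h))
    (L95 : ∀ U, new189 D U → ∀ p ∈ plaqsOf (half D),
      Ineq195 (D.devV'' U p) (dist1 (plaqHol (D.Uhalf U (D.boxOf p)) p)) D.α ((D.L ^ D.h)⁻¹) (D.ε D.h) (E124 D.ε D.L D.η D.k D.h))
    (L91 : ∀ U, new189 D U → ∀ j, D.h ≤ j → j ≤ D.k → ∀ p ∈ plaqsOf (dom D j),
      Ineq191 (dist1 (plaqHol (D.Upp U) p)) (D.dev97 U p) D.α ((D.L ^ j)⁻¹) (D.ε j) (E124 D.ε D.L D.η D.k j))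
    (L97 : ∀ U, new189 D U → ∀ j, D.h ≤ j → j ≤ D.k → ∀ p ∈ plaqsOf (dom D j),
      Ineq191 (D.dev97 U p) (D.dev0 U p) D.α ((D.L ^ j)⁻¹) (D.ε j) (E124 D.ε D.L D.η D.k j)) :
    B15Leaf (WOfRecord₁₃ F N θ ((lam.pinRPrime₁₃ θ).pinD189TH θ.ν θ.A₁ θ.τ9.M (gOfRecord₁₃ F N θ) σ s Nm N₀ p₁) P) := by
  by_cases hk : lam.kSel P < P.K
  · exact b15Leaf_WOfRecord₁₃_pinAllTH_of_massSel_of_flow θ lam σ s Nm N₀ p₁ hP hk hD hmassSel hfib hP1 h180 hN2 hNN hNk hβ0 hβ hL₀ hL₀L hB hδ hdist hN₀ hMl hε0 hε1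
      hβ₀0 hβ₀ hflow hZk hgeom hbox L91h L95 L91 L97
  · subst hD
    exact b15Leaf_WOfRecord₁₃_of_provisosInt_massSel θ _ (hdeg (not_lt.mp hk)) rfl hmassSel hfib hP1 h180
      (claim189_sitOfHist_of_flow (Nm P) P (σ P) (s P) (N₀ P) p₁ rfl hN2 hNN hNk hβ0 hβ hL₀ hL₀L hB hδ hdist hN₀ hMl hε0 hε1 hβ₀0 hβ₀ hflow hZk hgeom hbox
        L91h L95 L91 L97 h180)

end LeafT

/-! ## §3 The [IV] leaf at `λᶻ₁₃` with `N₀` of Record 13: print's `Z″_j` pinned, «We have j = k» discharged, `2 ≤ N₀` from the top coupling -/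

section LeafZ

variable (θ : Stage13Params F N) (lam : ResidW F N) (σ : ∀ P : B12.RunParams, Sit189 F N P.K)
  (s : ∀ P : B12.RunParams, SeqOfRecord F θ.ν θ.τ9.M (gOfRecord₁₃ F N θ P) P.K (lam.kSel P + 1)) (Nm : B12.RunParams → ℕ)
  (enl : ∀ P : B12.RunParams, ℕ → ℕ → Set (Site (F.P P.K) 0) → Set (Site (F.P P.K) 0)) (p₁ : ℕ)

/-- **★ THE [IV] LEAF OF RECORD 13's BUNDLE AT THE `Z″`-PINNED LAYER `λᶻ₁₃` WITH `N₀ P := N0OfRecord₁₃ θ P (kSel P + 1)`, WINDOW-FREE FORM**: as §2 with the located input `hZk` («We have j = k»)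
DISCHARGED by module 13's `zppOfChain_hZk` (enlargement inflationary) and `2 ≤ N₀` from `1 < (log g_k⁻²)^r`; print's first p. 200 condition displayed at `N₀` of the record's history (module 14's
`printCond1_N0OfSeq_of_threshold` supplies it from one threshold + `β₁₃ ≥ 0` along the history). [cite: Balaban1989LargeFieldI, (0.2)–(0.6) p.176, (1.10)–(1.11) p.179, (1.89) p.198, pp.199–200; Balaban1988Convergent, (2.5)–(2.8) pp.255–256] -/
theorem b15Leaf_WOfRecord₁₃_pinAllZH_N0_of_massSel_of_flow (hP : θ.Provisos₁₃ F N) {P : B12.RunParams} (hk : lam.kSel P < P.K)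
    (henl : ∀ n j (S : Set (Site (F.P P.K) 0)), S ⊆ enl P n j S)
    {D : Setting189 (F.P P.K) (SU N) (MSField (F.P P.K) (SU N) × ((j : ℕ) → VecField (F.P P.K) j (EuclideanSpace ℝ (Fin (N ^ 2 - 1))))) (Pt (F.P P.K).d)}
    (hD : D = ((lam.pinRPrime₁₃ θ).pinD189ZH θ.ν θ.A₁ θ.τ9.M (gOfRecord₁₃ F N θ) σ s Nm (fun P => N0OfRecord₁₃ θ P (lam.kSel P + 1)) enl p₁).D189 P)
    (hmassSel : ∀ t, 0 < ∫ V, rterm (reprTOfRecord₁₃ F N θ P (lam.kSel P)) (θ.ppSel P (gOfRecord₁₃ F N θ P) (lam.kSel P + 1) t) V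
      ∂(fieldMeasure (F.P P.K) (lam.kSel P + 1) (SU N)))
    (hfib : ∀ t, ∃ t', θ.ppSel P (gOfRecord₁₃ F N θ P) (lam.kSel P + 1) t' = θ.ppSel P (gOfRecord₁₃ F N θ P) (lam.kSel P + 1) t ∧
      0 < ∫ V, rterm (reprTOfRecord₁₃ F N θ P (lam.kSel P)) t' V ∂(fieldMeasure (F.P P.K) (lam.kSel P + 1) (SU N)))
    (hP1 : Prop1Printed (lam.LF P))
    (h180 : ∀ U, new189 D U → ∀ i, D.h ≤ i → i ≤ D.k → ∀ q ∈ plaqsOf (dom D i), Ineq180 (D.dev0 U q) (D.ε D.k) D.η D.B₃ D.B₅ D.M D.δ (D.dist q) D.O1)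
    (hlog : 1 < (Real.log (gOfRecord₁₃ F N θ P (lam.kSel P + 1) ^ 2)⁻¹) ^ θ.ν.r)
    (hNN : N0OfRecord₁₃ θ P (lam.kSel P + 1) ≤ Nm P) (hNk : N0OfRecord₁₃ θ P (lam.kSel P + 1) ≤ lam.kSel P + 1)
    (hβ0 : 0 ≤ (σ P).β) (hβ : (σ P).β ≤ 1 / 4) (hL₀ : 2 ≤ (σ P).L₀) (hL₀L : (σ P).L₀ ^ 2 ≤ ((F.P P.K).L : ℝ))
    (hB : 0 ≤ (σ P).O1 * (σ P).B₃ * (σ P).B₅) (hδ : 0 ≤ (σ P).δ) (hdist : ∀ p, 0 ≤ (σ P).dist p)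
    (hN₀ : (2 + (121 / 120) ^ 2 * ((σ P).O1 * (σ P).B₃ * (σ P).B₅ * (θ.τ9.M : ℝ) ^ 5)) * (((σ P).L₀ ^ 2) ^ (N0OfRecord₁₃ θ P (lam.kSel P + 1) - 1))⁻¹ ≤ 1 / 4)
    (hMl : (121 / 120) ^ 2 * ((σ P).O1 * (σ P).B₃ * (σ P).B₅ * (θ.τ9.M : ℝ) ^ 5) * Real.exp (-(4 * (σ P).δ * (θ.τ9.M : ℝ))) ≤ 1 / 12)
    (hε0 : ∀ i, lam.kSel P + 1 - Nm P ≤ i → i ≤ lam.kSel P + 1 → 0 ≤ epsOfRecord θ.ν (gOfRecord₁₃ F N θ P) i)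
    (hε1 : ∀ i, lam.kSel P + 1 - Nm P ≤ i → i ≤ lam.kSel P + 1 → epsOfRecord θ.ν (gOfRecord₁₃ F N θ P) i ≤ 1 / 10)
    {β₀ : ℝ} (hβ₀0 : 0 ≤ β₀) (hβ₀ : β₀ ≤ 1 / 2)
    (hflow : ∀ j, lam.kSel P + 1 - Nm P ≤ j → j < lam.kSel P + 1 →
      epsOfRecord θ.ν (gOfRecord₁₃ F N θ P) (lam.kSel P + 1) ≤ (1 + β₀) * Real.sqrt ((lam.kSel P + 1 - j : ℕ) : ℝ) * epsOfRecord θ.ν (gOfRecord₁₃ F N θ P) j)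
    (hgeom : ∀ m, D.k₀ < m → m < D.k → ∀ p ∈ plaqsOf (D.Ω m \ D.Ω (m + 1)), 4 * ((m : ℝ) - D.k₀) * D.M ≤ D.dist p)
    (hbox : ∀ p ∈ plaqsOf (half D), D.boxOf p ∈ D.halfcubes ∧ p ∈ D.plaqT (D.boxOf p))
    (L91h : ∀ U, new189 D U → ∀ p ∈ plaqsOf (half D),
      Ineq191 (dist1 (plaqHol (D.Upp U) p)) (D.devV'' U p) D.α ((D.L ^ D.h)⁻¹) (D.ε D.h) (E124 D.ε D.L D.η D.k D.h))
    (L95 : ∀ U, new189 D U → ∀ p ∈ plaqsOf (half D),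
      Ineq195 (D.devV'' U p) (dist1 (plaqHol (D.Uhalf U (D.boxOf p)) p)) D.α ((D.L ^ D.h)⁻¹) (D.ε D.h) (E124 D.ε D.L D.η D.k D.h))
    (L91 : ∀ U, new189 D U → ∀ j, D.h ≤ j → j ≤ D.k → ∀ p ∈ plaqsOf (dom D j),
      Ineq191 (dist1 (plaqHol (D.Upp U) p)) (D.dev97 U p) D.α ((D.L ^ j)⁻¹) (D.ε j) (E124 D.ε D.L D.η D.k j))
    (L97 : ∀ U, new189 D U → ∀ j, D.h ≤ j → j ≤ D.k → ∀ p ∈ plaqsOf (dom D j),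
      Ineq191 (D.dev97 U p) (D.dev0 U p) D.α ((D.L ^ j)⁻¹) (D.ε j) (E124 D.ε D.L D.η D.k j)) :
    B15Leaf (WOfRecord₁₃ F N θ ((lam.pinRPrime₁₃ θ).pinD189ZH θ.ν θ.A₁ θ.τ9.M (gOfRecord₁₃ F N θ) σ s Nm (fun P => N0OfRecord₁₃ θ P (lam.kSel P + 1)) enl p₁) P) := by
  subst hD
  exact b15Leaf_WOfRecord₁₃_of_massSel θ _ hP hk rfl hmassSel hfib hP1 h180
    (claim189_sitOfHist_N0Z_of_flow (Nm P) P (σ P) (s P) p₁ (enl P) henl rfl hlog hNN hNk hβ0 hβ hL₀ hL₀L hB hδ hdist hN₀ hMl hε0 hε1 hβ₀0 hβ₀ hflow hgeom hbox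
      L91h L95 L91 L97 h180)

/-- **★ THE [IV] LEAF AT `λᵀ₁₃` WITH `N₀ P := N0OfRecord₁₃ θ P (kSel P + 1)`, WINDOW FORM** (module 14's `claim189_sitOfHist₁₃_N0_of_inInterval`): `2 ≤ N₀` from `r ≥ 1` and the (2.7)-small
window, print's first p. 200 condition from ONE threshold on `g_{kSel P+1}` and `β₁₃ ≥ 0` along the run's history, flow inputs from the window + the BOX bound on `betaOfRecord₁₃ θ`; per-run
memory `N P ≥ N₀ P` displayed. [cite: Balaban1989LargeFieldI, (0.2)–(0.6) p.176, (1.89) p.198, pp.199–200; Balaban1988Convergent, (2.1) p.254, (2.4)–(2.8) pp.255–256; Balaban1987RG1, §1 p.264] -/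
theorem b15Leaf_WOfRecord₁₃_pinAllTH_N0_of_massSel (hP : θ.Provisos₁₃ F N) {P : B12.RunParams} (hk : lam.kSel P < P.K)
    {D : Setting189 (F.P P.K) (SU N) (MSField (F.P P.K) (SU N) × ((j : ℕ) → VecField (F.P P.K) j (EuclideanSpace ℝ (Fin (N ^ 2 - 1))))) (Pt (F.P P.K).d)}
    (hD : D = ((lam.pinRPrime₁₃ θ).pinD189TH θ.ν θ.A₁ θ.τ9.M (gOfRecord₁₃ F N θ) σ s Nm (fun P => N0OfRecord₁₃ θ P (lam.kSel P + 1)) p₁).D189 P)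
    (hmassSel : ∀ t, 0 < ∫ V, rterm (reprTOfRecord₁₃ F N θ P (lam.kSel P)) (θ.ppSel P (gOfRecord₁₃ F N θ P) (lam.kSel P + 1) t) V
      ∂(fieldMeasure (F.P P.K) (lam.kSel P + 1) (SU N)))
    (hfib : ∀ t, ∃ t', θ.ppSel P (gOfRecord₁₃ F N θ P) (lam.kSel P + 1) t' = θ.ppSel P (gOfRecord₁₃ F N θ P) (lam.kSel P + 1) t ∧
      0 < ∫ V, rterm (reprTOfRecord₁₃ F N θ P (lam.kSel P)) t' V ∂(fieldMeasure (F.P P.K) (lam.kSel P + 1) (SU N)))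
    (hP1 : Prop1Printed (lam.LF P))
    (h180 : ∀ U, new189 D U → ∀ i, D.h ≤ i → i ≤ D.k → ∀ q ∈ plaqsOf (dom D i), Ineq180 (D.dev0 U q) (D.ε D.k) D.η D.B₃ D.B₅ D.M D.δ (D.dist q) D.O1)
    (hr : 1 ≤ θ.ν.r) (hNN : N0OfRecord₁₃ θ P (lam.kSel P + 1) ≤ Nm P) (hNk : N0OfRecord₁₃ θ P (lam.kSel P + 1) ≤ lam.kSel P + 1)
    (hβ0 : 0 ≤ (σ P).β) (hβ : (σ P).β ≤ 1 / 4) (hL₀ : 2 ≤ (σ P).L₀) (hL₀L : (σ P).L₀ ^ 2 ≤ ((F.P P.K).L : ℝ))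
    (hB : 0 ≤ (σ P).O1 * (σ P).B₃ * (σ P).B₅) (hδ : 0 ≤ (σ P).δ) (hdist : ∀ p, 0 ≤ (σ P).dist p)
    (hwin : 4 * (2 + (121 / 120) ^ 2 * ((σ P).O1 * (σ P).B₃ * (σ P).B₅ * (θ.τ9.M : ℝ) ^ 5))
      ≤ ((Real.log (gOfRecord₁₃ F N θ P (lam.kSel P + 1) ^ 2)⁻¹) ^ θ.ν.r) ^ (Real.log ((σ P).L₀ ^ 2) / Real.log ((F.P P.K).L : ℝ)))
    (hβhist : ∀ j, j < lam.kSel P + 1 → 0 ≤ betaOfRecord₁₃ F N θ j (prefixOf (gOfRecord₁₃ F N θ P) j))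
    (hMl : (121 / 120) ^ 2 * ((σ P).O1 * (σ P).B₃ * (σ P).B₅ * (θ.τ9.M : ℝ) ^ 5) * Real.exp (-(4 * (σ P).δ * (θ.τ9.M : ℝ))) ≤ 1 / 12)
    (hA₀ : 0 ≤ θ.ν.A₀) {β' β₀ : ℝ} {L : ℕ} (S : SmallnessFor θ.γ β' β₀ L θ.ν.p₀) (hβ₀ : β₀ ≤ 1 / 2) (hε10 : θ.γ * p0Profile θ.ν.A₀ θ.ν.p₀ θ.γ ≤ 1 / 10)
    (hI : Step.InInterval θ.γ (lam.kSel P + 1) (gOfRecord₁₃ F N θ P)) (hup : BetaUpperH β' θ.γ (betaOfRecord₁₃ F N θ))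
    (hZk : ∀ m, lam.kSel P + 1 - N0OfRecord₁₃ θ P (lam.kSel P + 1) < m → m < lam.kSel P + 1 →
      (σ P).Zpp (lam.kSel P + 1) ∩ omegaOfChain (s P) m ⊆ omegaOfChain (s P) (m + 1))
    (hgeom : ∀ m, D.k₀ < m → m < D.k → ∀ p ∈ plaqsOf (D.Ω m \ D.Ω (m + 1)), 4 * ((m : ℝ) - D.k₀) * D.M ≤ D.dist p)
    (hbox : ∀ p ∈ plaqsOf (half D), D.boxOf p ∈ D.halfcubes ∧ p ∈ D.plaqT (D.boxOf p))
    (L91h : ∀ U, new189 D U → ∀ p ∈ plaqsOf (half D),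
      Ineq191 (dist1 (plaqHol (D.Upp U) p)) (D.devV'' U p) D.α ((D.L ^ D.h)⁻¹) (D.ε D.h) (E124 D.ε D.L D.η D.k D.h))
    (L95 : ∀ U, new189 D U → ∀ p ∈ plaqsOf (half D),
      Ineq195 (D.devV'' U p) (dist1 (plaqHol (D.Uhalf U (D.boxOf p)) p)) D.α ((D.L ^ D.h)⁻¹) (D.ε D.h) (E124 D.ε D.L D.η D.k D.h))
    (L91 : ∀ U, new189 D U → ∀ j, D.h ≤ j → j ≤ D.k → ∀ p ∈ plaqsOf (dom D j),
      Ineq191 (dist1 (plaqHol (D.Upp U) p)) (D.dev97 U p) D.α ((D.L ^ j)⁻¹) (D.ε j) (E124 D.ε D.L D.η D.k j))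
    (L97 : ∀ U, new189 D U → ∀ j, D.h ≤ j → j ≤ D.k → ∀ p ∈ plaqsOf (dom D j),
      Ineq191 (D.dev97 U p) (D.dev0 U p) D.α ((D.L ^ j)⁻¹) (D.ε j) (E124 D.ε D.L D.η D.k j)) :
    B15Leaf (WOfRecord₁₃ F N θ ((lam.pinRPrime₁₃ θ).pinD189TH θ.ν θ.A₁ θ.τ9.M (gOfRecord₁₃ F N θ) σ s Nm (fun P => N0OfRecord₁₃ θ P (lam.kSel P + 1)) p₁) P) := by
  subst hD
  exact b15Leaf_WOfRecord₁₃_of_massSel θ _ hP hk rfl hmassSel hfib hP1 h180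
    (claim189_sitOfHist₁₃_N0_of_inInterval (Nm P) P (σ P) (s P) p₁ rfl hr hNN hNk hβ0 hβ hL₀ hL₀L hB hδ hdist hwin hβhist hMl hA₀ S hβ₀ hε10 hI hup hZk hgeom hbox
      L91h L95 L91 L97 h180)

end LeafZ

/-! ## §4 The θ-keyed socket face: `B15Leaf ((θ.pinW (WOfRecord₁₃ θ λᵀ₁₃)).res.W P)` — n24-c's `h12` row at the W-pinned Stage-13 parameter -/

section Socket

variable (θ : Stage13Params F N) (lam : ResidW F N) (σ : ∀ P : B12.RunParams, Sit189 F N P.K)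
  (s : ∀ P : B12.RunParams, SeqOfRecord F θ.ν θ.τ9.M (gOfRecord₁₃ F N θ P) P.K (lam.kSel P + 1)) (Nm N₀ : B12.RunParams → ℕ) (p₁ : ℕ)

/-- At the W-pinned parameter `θ.pinW (WOfRecord₁₃ θ λ)` the residual W carrier IS the bundle of record (`rfl`), and the bundle read at the pinned parameter is the same (`WOfRecord₁₃_pins`):
so n24-c's θ-keyed socket `B15Leaf (θ'.res.W P)` at `θ' := θ.pinW (WOfRecord₁₃ θ λᵀ₁₃)` IS `B15Leaf (WOfRecord₁₃ θ λᵀ₁₃ P)`. [cite: Balaban1989LargeFieldI, (0.2) p.176 (bookkeeping)] -/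
theorem res_W_pinW_pinAllTH (P : B12.RunParams) :
    (θ.pinW F N (WOfRecord₁₃ F N θ ((lam.pinRPrime₁₃ θ).pinD189TH θ.ν θ.A₁ θ.τ9.M (gOfRecord₁₃ F N θ) σ s Nm N₀ p₁))).res.W P =
      WOfRecord₁₃ F N θ ((lam.pinRPrime₁₃ θ).pinD189TH θ.ν θ.A₁ θ.τ9.M (gOfRecord₁₃ F N θ) σ s Nm N₀ p₁) P ∧
    WOfRecord₁₃ F N (θ.pinW F N (WOfRecord₁₃ F N θ ((lam.pinRPrime₁₃ θ).pinD189TH θ.ν θ.A₁ θ.τ9.M (gOfRecord₁₃ F N θ) σ s Nm N₀ p₁)))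
        ((lam.pinRPrime₁₃ θ).pinD189TH θ.ν θ.A₁ θ.τ9.M (gOfRecord₁₃ F N θ) σ s Nm N₀ p₁) P =
      WOfRecord₁₃ F N θ ((lam.pinRPrime₁₃ θ).pinD189TH θ.ν θ.A₁ θ.τ9.M (gOfRecord₁₃ F N θ) σ s Nm N₀ p₁) P := ⟨rfl, rfl⟩

/-- **The W-pinned Stage-13 parameter keeps `Provisos₁₃`** (n10-d's `Provisos₁₃.pinW`) — so §2's leaf theorems apply verbatim at `θ.pinW (WOfRecord₁₃ θ λᵀ₁₃)` and deliver the θ-keyed socket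
`∀`-row there run by run. [cite: Balaban1989LargeFieldI, (0.2) p.176 (bookkeeping)] -/
theorem provisos₁₃_pinW_pinAllTH (hP : θ.Provisos₁₃ F N) :
    (θ.pinW F N (WOfRecord₁₃ F N θ ((lam.pinRPrime₁₃ θ).pinD189TH θ.ν θ.A₁ θ.τ9.M (gOfRecord₁₃ F N θ) σ s Nm N₀ p₁))).Provisos₁₃ F N :=
  hP.pinW _

end Socket

end Summit.QuantumFields.YangMills.BalabanUVNodes.N12AtRecord13TermPin

end
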